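import Summits.Ventures.PercRepro.Night2FatZThreeB
import Summits.Ventures.PercRepro.Night2FatDegSingle

/-!
# night-2: the witnesses of the singly degenerate regime at small `N` — side points, free points, unloaded singletons — the preamble facts, part 1

**`exists_small_witnesses_deg`**: for every lossy basis pair of the singly degenerate regime there are sets `U` of side
points, `V` of free points and `E` of points on no non-class basis line (unloaded singletons) of `W ∖ {x}` in one of
four patterns: (α) the line of `M` is not a non-class basis line, `|U| = 2`, `|V| = 1`, `|E| ≥ 2`;
(β) `|U| = 1`, `|V| = 3`, `|E| ≥ 2`; (γ) `|U| = 2`, `|V| = 2`, `|E| ≥ 1`; (δ) `|U| = 1`, `|V| = 2`, `|E| ≥ 3`.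
Each pattern gives the fair share at `N = 6, 7, 8` (`Night2FatDegNumIccA/B`).  The case analysis follows
`exists_side_and_free_deg`: `|P₂| ∈ {0, 1, 2, 3}` basis points of `π₂` off the spine.
Paper `proofs/NIGHT-2-g35.md` §5.
-/

namespace PercRepro.Shadow

open PercRepro.ThmH PercRepro.PerFlat

variable {α : Type*} [DecidableEq α] {M : Matroid α} [M.Finite] {G : Finset α}

/-- `|M| = |P₃| + |M'|`: the side points split into basis points and points of `W`. -/
theorem deg_wit_msplit {w₀ x : α} {R₁ : Finset α} {c₂ c₃ : α} {B : Finset α} {z : α} (hd : (gr M \ G).card = 2)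
    (hk : kColoops M G = 1) (hfat : (fatClosures M 5 G 2).card ≤ 1) (hR₁2 : rkN M R₁ = 2) (hR₁3 : 3 ≤ R₁.card)
    (hcop : rkN M (insert w₀ (insert x R₁)) ≤ 3)
    (hnd₂ : 3 ≤ rkN M (((G \ coloops M G) \ {w₀, x}).filter (fun e => e ∈ clF M (insert c₂ R₁) ∧ e ∉ clF M R₁)))
    (hdeg₃ : rkN M (((G \ coloops M G) \ {w₀, x}).filter (fun e => e ∈ clF M (insert c₃ R₁) ∧ e ∉ clF M R₁)) ≤ 2)
    {V P W Mset P₃ M' : Finset α} (hV : V = (G \ coloops M G) \ {w₀, x})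
    (hP : P = (insert z B \ coloops M G).erase w₀) (hW : W = (G \ insert z B).erase x)
    (hMset : Mset = V.filter (fun e => e ∈ clF M (insert c₃ R₁) ∧ e ∉ clF M R₁))
    (hP₃ : P₃ = P.filter (fun e => e ∈ Mset)) (hM' : M' = W.filter (fun e => e ∈ Mset)) (hPW : ∀ e ∈ P, e ∉ W)
    (hP4 : P.card = 4) (hPorW : ∀ e ∈ V, e ∈ P ∨ e ∈ W) (hM3 : 3 ≤ Mset.card) (hM2 : 1 < Mset.card)
    (hP₃2 : P₃.card ≤ 2) :
    Mset.card = P₃.card + M'.card := by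
  subst hV hP hW hMset hP₃ hM'
  set V := (G \ coloops M G) \ {w₀, x} with hV
  set P := (insert z B \ coloops M G).erase w₀ with hP
  set W := (G \ insert z B).erase x with hW
  set Mset := V.filter (fun e => e ∈ clF M (insert c₃ R₁) ∧ e ∉ clF M R₁) with hMset
  set P₃ := P.filter (fun e => e ∈ Mset) with hP₃
  set M' := W.filter (fun e => e ∈ Mset) with hM'
  have _u := hd
  have _u := hk
  have _u := hfat
  have _u := hR₁2
  have _u := hR₁3
  have _u := hcop
  have _u := hnd₂
  have _u := hdeg₃
  have _u := hP4
  have _u := hM3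
  have _u := hM2
  have _u := hP₃2
  have hMmem : ∀ e, e ∈ Mset → e ∈ V := fun e he => by
    rw [hMset] at he
    exact (Finset.mem_filter.1 he).1
  have heq : Mset = P₃ ∪ M' := by
    ext e
    constructor
    · intro he
      rcases hPorW e (hMmem e he) with h | h
      · exact Finset.mem_union_left _ (Finset.mem_filter.2 ⟨h, he⟩)
      · exact Finset.mem_union_right _ (Finset.mem_filter.2 ⟨h, he⟩)
    · intro he
      rcases Finset.mem_union.1 he with h | h
      · exact (Finset.mem_filter.1 h).2
      · exact (Finset.mem_filter.1 h).2
  have hdisj : Disjoint P₃ M' := by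
    rw [Finset.disjoint_left]
    intro e he₁ he₂
    exact hPW e (Finset.mem_filter.1 he₁).1 (Finset.mem_filter.1 he₂).1
  rw [heq, Finset.card_union_of_disjoint hdisj]

/-- `|L₀| + |P₂| ≤ 3`: the basis points of `π₂` are independent in a rank-3 plane. -/
theorem deg_wit_l0p2 {w₀ x : α} {R₁ : Finset α} {c₂ c₃ : α} {B : Finset α} {z : α} (hd : (gr M \ G).card = 2)
    (hk : kColoops M G = 1) (hfat : (fatClosures M 5 G 2).card ≤ 1) (hR₁2 : rkN M R₁ = 2) (hR₁3 : 3 ≤ R₁.card)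
    (hcop : rkN M (insert w₀ (insert x R₁)) ≤ 3)
    (hnd₂ : 3 ≤ rkN M (((G \ coloops M G) \ {w₀, x}).filter (fun e => e ∈ clF M (insert c₂ R₁) ∧ e ∉ clF M R₁)))
    (hdeg₃ : rkN M (((G \ coloops M G) \ {w₀, x}).filter (fun e => e ∈ clF M (insert c₃ R₁) ∧ e ∉ clF M R₁)) ≤ 2)
    {V P W Mset P₃ M' L₀ P₂ : Finset α} (hV : V = (G \ coloops M G) \ {w₀, x})
    (hP : P = (insert z B \ coloops M G).erase w₀) (hW : W = (G \ insert z B).erase x)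
    (hMset : Mset = V.filter (fun e => e ∈ clF M (insert c₃ R₁) ∧ e ∉ clF M R₁))
    (hP₃ : P₃ = P.filter (fun e => e ∈ Mset)) (hM' : M' = W.filter (fun e => e ∈ Mset))
    (hL₀ : L₀ = P.filter (fun e => e ∈ clF M R₁))
    (hP₂ : P₂ = P.filter (fun e => e ∈ clF M (insert c₂ R₁) ∧ e ∉ clF M R₁)) (hP4 : P.card = 4)
    (hM3 : 3 ≤ Mset.card) (hM2 : 1 < Mset.card) (hP₃2 : P₃.card ≤ 2) (hMsplit : Mset.card = P₃.card + M'.card)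
    (hM'1 : 1 ≤ M'.card) (hL₀2 : L₀.card ≤ 2) (hπ₂3 : (P.filter (fun e => e ∈ clF M (insert c₂ R₁))).card ≤ 3) :
    L₀.card + P₂.card ≤ 3 := by
  subst hV hP hW hMset hP₃ hM' hL₀ hP₂
  set V := (G \ coloops M G) \ {w₀, x} with hV
  set P := (insert z B \ coloops M G).erase w₀ with hP
  set W := (G \ insert z B).erase x with hW
  set Mset := V.filter (fun e => e ∈ clF M (insert c₃ R₁) ∧ e ∉ clF M R₁) with hMset
  set P₃ := P.filter (fun e => e ∈ Mset) with hP₃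
  set M' := W.filter (fun e => e ∈ Mset) with hM'
  set L₀ := P.filter (fun e => e ∈ clF M R₁) with hL₀
  set P₂ := P.filter (fun e => e ∈ clF M (insert c₂ R₁) ∧ e ∉ clF M R₁) with hP₂
  have _u := hd
  have _u := hk
  have _u := hfat
  have _u := hR₁2
  have _u := hR₁3
  have _u := hcop
  have _u := hnd₂
  have _u := hdeg₃
  have _u := hP4
  have _u := hM3
  have _u := hM2
  have _u := hP₃2
  have _u := hMsplit
  have _u := hM'1
  have _u := hL₀2
  have _u := hπ₂3
  have heq : P.filter (fun e => e ∈ clF M (insert c₂ R₁)) = L₀ ∪ P₂ := by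
    ext e
    rw [Finset.mem_union, hL₀, hP₂, Finset.mem_filter, Finset.mem_filter, Finset.mem_filter]
    constructor
    · rintro ⟨he, he2⟩
      by_cases heL : e ∈ clF M R₁
      · exact Or.inl ⟨he, heL⟩
      · exact Or.inr ⟨he, he2, heL⟩
    · rintro (⟨he, heL⟩ | ⟨he, he2, -⟩)
      · exact ⟨he, clF_mono (Finset.subset_insert _ _) heL⟩
      · exact ⟨he, he2⟩
  have hdisj : Disjoint L₀ P₂ := by
    rw [Finset.disjoint_left]
    intro e he₁ he₂
    exact (Finset.mem_filter.1 he₂).2.2 (Finset.mem_filter.1 he₁).2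
  rw [heq, Finset.card_union_of_disjoint hdisj] at hπ₂3
  exact hπ₂3

/-- `|L₀| + |P₂| + |P₃| = 4`: every basis point is on the spine, in `π₂` off it, or in `π₃` off it. -/
theorem deg_wit_split {w₀ x : α} {R₁ : Finset α} {c₂ c₃ : α} {B : Finset α} {z : α} (hd : (gr M \ G).card = 2)
    (hk : kColoops M G = 1) (hfat : (fatClosures M 5 G 2).card ≤ 1) (hR₁2 : rkN M R₁ = 2) (hR₁3 : 3 ≤ R₁.card)
    (hcop : rkN M (insert w₀ (insert x R₁)) ≤ 3) (hc₂ : c₂ ∉ clF M R₁) (hc₃ : c₃ ∉ clF M (insert c₂ R₁))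
    (hcover : ∀ e ∈ (G \ coloops M G) \ {w₀, x}, e ∈ clF M (insert c₂ R₁) ∨ e ∈ clF M (insert c₃ R₁))
    (hnd₂ : 3 ≤ rkN M (((G \ coloops M G) \ {w₀, x}).filter (fun e => e ∈ clF M (insert c₂ R₁) ∧ e ∉ clF M R₁)))
    (hdeg₃ : rkN M (((G \ coloops M G) \ {w₀, x}).filter (fun e => e ∈ clF M (insert c₃ R₁) ∧ e ∉ clF M R₁)) ≤ 2)
    {V P W Mset P₃ M' L₀ P₂ : Finset α} (hV : V = (G \ coloops M G) \ {w₀, x})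
    (hP : P = (insert z B \ coloops M G).erase w₀) (hW : W = (G \ insert z B).erase x)
    (hMset : Mset = V.filter (fun e => e ∈ clF M (insert c₃ R₁) ∧ e ∉ clF M R₁))
    (hP₃ : P₃ = P.filter (fun e => e ∈ Mset)) (hM' : M' = W.filter (fun e => e ∈ Mset))
    (hL₀ : L₀ = P.filter (fun e => e ∈ clF M R₁))
    (hP₂ : P₂ = P.filter (fun e => e ∈ clF M (insert c₂ R₁) ∧ e ∉ clF M R₁)) (hPV : P ⊆ V) (hP4 : P.card = 4)
    (hR₁g : R₁ ⊆ gr M) (hc₂g : c₂ ∈ gr M) (hc₃g : c₃ ∈ gr M) (hM3 : 3 ≤ Mset.card) (hM2 : 1 < Mset.card)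
    (hP₃2 : P₃.card ≤ 2) (hMsplit : Mset.card = P₃.card + M'.card) (hM'1 : 1 ≤ M'.card) (hL₀2 : L₀.card ≤ 2)
    (hπ₂3 : (P.filter (fun e => e ∈ clF M (insert c₂ R₁))).card ≤ 3) (hL₀P₂ : L₀.card + P₂.card ≤ 3) :
    L₀.card + P₂.card + P₃.card = 4 := by
  subst hV hP hW hMset hP₃ hM' hL₀ hP₂
  set V := (G \ coloops M G) \ {w₀, x} with hV
  set P := (insert z B \ coloops M G).erase w₀ with hP
  set W := (G \ insert z B).erase x with hW
  set Mset := V.filter (fun e => e ∈ clF M (insert c₃ R₁) ∧ e ∉ clF M R₁) with hMset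
  set P₃ := P.filter (fun e => e ∈ Mset) with hP₃
  set M' := W.filter (fun e => e ∈ Mset) with hM'
  set L₀ := P.filter (fun e => e ∈ clF M R₁) with hL₀
  set P₂ := P.filter (fun e => e ∈ clF M (insert c₂ R₁) ∧ e ∉ clF M R₁) with hP₂
  have _u := hd
  have _u := hk
  have _u := hfat
  have _u := hR₁2
  have _u := hR₁3
  have _u := hcop
  have _u := hnd₂
  have _u := hdeg₃
  have _u := hP4
  have _u := hM3
  have _u := hM2
  have _u := hP₃2
  have _u := hMsplit
  have _u := hM'1
  have _u := hL₀2
  have _u := hπ₂3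
  have _u := hL₀P₂
  have heq : P = L₀ ∪ (P₂ ∪ P₃) := by
    ext e
    rw [Finset.mem_union, Finset.mem_union, hL₀, hP₂, hP₃, Finset.mem_filter, Finset.mem_filter,
      Finset.mem_filter]
    constructor
    · intro he
      rcases spine_or_plane_or_side hcover (hPV he) with h | h | h
      · exact Or.inl ⟨he, h⟩
      · exact Or.inr (Or.inl ⟨he, h⟩)
      · exact Or.inr (Or.inr ⟨he, Finset.mem_filter.2 ⟨hPV he, h⟩⟩)
    · rintro (h | h | h) <;> exact h.1
  have hd1 : Disjoint L₀ (P₂ ∪ P₃) := by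
    rw [Finset.disjoint_left]
    intro e he₁ he₂
    rw [hL₀, Finset.mem_filter] at he₁
    rw [Finset.mem_union, hP₂, hP₃, Finset.mem_filter, Finset.mem_filter] at he₂
    rcases he₂ with h | h
    · exact h.2.2 he₁.2
    · exact (Finset.mem_filter.1 h.2).2.2 he₁.2
  have hd2 : Disjoint P₂ P₃ := by
    rw [Finset.disjoint_left]
    intro e he₁ he₂
    rw [hP₂, Finset.mem_filter] at he₁
    rw [hP₃, Finset.mem_filter] at he₂
    exact he₁.2.2 (mem_clF_of_mem_two_planes hR₁g hc₂g hc₃g hc₂ hc₃ he₁.2.1 (Finset.mem_filter.1 he₂.2).2.1)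
  rw [heq, Finset.card_union_of_disjoint hd1, Finset.card_union_of_disjoint hd2] at hP4
  omega

/-- A spine point of `W` off `clF M` is free when `|L₀| ≤ 1`. -/
theorem deg_wit_freeL {w₀ x : α} {R₁ : Finset α} {c₂ c₃ : α} {B : Finset α} {z : α} (hd : (gr M \ G).card = 2)
    (hk : kColoops M G = 1) (hs : ∀ e ∈ gr M, ∀ f ∈ gr M, e ≠ f → rkN M {e, f} = 2)
    (hfat : (fatClosures M 5 G 2).card ≤ 1) (hR₁V : R₁ ⊆ (G \ coloops M G) \ {w₀, x}) (hR₁2 : rkN M R₁ = 2)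
    (hR₁3 : 3 ≤ R₁.card) (hcop : rkN M (insert w₀ (insert x R₁)) ≤ 3) (hc₂V : c₂ ∈ (G \ coloops M G) \ {w₀, x})
    (hc₃V : c₃ ∈ (G \ coloops M G) \ {w₀, x}) (hc₂ : c₂ ∉ clF M R₁) (hc₃ : c₃ ∉ clF M (insert c₂ R₁))
    (hcover : ∀ e ∈ (G \ coloops M G) \ {w₀, x}, e ∈ clF M (insert c₂ R₁) ∨ e ∈ clF M (insert c₃ R₁))
    (hnd₂ : 3 ≤ rkN M (((G \ coloops M G) \ {w₀, x}).filter (fun e => e ∈ clF M (insert c₂ R₁) ∧ e ∉ clF M R₁)))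
    (hdeg₃ : rkN M (((G \ coloops M G) \ {w₀, x}).filter (fun e => e ∈ clF M (insert c₃ R₁) ∧ e ∉ clF M R₁)) ≤ 2)
    {V P W Mset P₃ M' L₀ P₂ Aset Lset : Finset α} (hV : V = (G \ coloops M G) \ {w₀, x})
    (hP : P = (insert z B \ coloops M G).erase w₀) (hW : W = (G \ insert z B).erase x)
    (hMset : Mset = V.filter (fun e => e ∈ clF M (insert c₃ R₁) ∧ e ∉ clF M R₁))
    (hP₃ : P₃ = P.filter (fun e => e ∈ Mset)) (hM' : M' = W.filter (fun e => e ∈ Mset))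
    (hL₀ : L₀ = P.filter (fun e => e ∈ clF M R₁))
    (hP₂ : P₂ = P.filter (fun e => e ∈ clF M (insert c₂ R₁) ∧ e ∉ clF M R₁))
    (hAset : Aset = V.filter (fun e => e ∈ clF M (insert c₂ R₁) ∧ e ∉ clF M R₁))
    (hLset : Lset = V.filter (fun e => e ∈ clF M R₁)) (hVg : V ⊆ gr M) (hPV : P ⊆ V) (hWV : W ⊆ V)
    (hPW : ∀ e ∈ P, e ∉ W) (hP4 : P.card = 4) (hM3 : 3 ≤ Mset.card) (hM2 : 1 < Mset.card) (hP₃2 : P₃.card ≤ 2)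
    (hMsplit : Mset.card = P₃.card + M'.card) (hM'1 : 1 ≤ M'.card) (hL₀2 : L₀.card ≤ 2)
    (hπ₂3 : (P.filter (fun e => e ∈ clF M (insert c₂ R₁))).card ≤ 3) (hL₀P₂ : L₀.card + P₂.card ≤ 3)
    (hsplit : L₀.card + P₂.card + P₃.card = 4) (hL3 : 3 ≤ Lset.card) :
    L₀.card ≤ 1 → ∀ s ∈ W, s ∈ clF M R₁ → s ∉ clF M Mset → (∀ c ∈ P₂, ∀ c' ∈ P₂, c ≠ c' → s ∈ clF M {c, c'} → rkN
      M (insert w₀ (insert x {c, c'})) ≤ 3 → 4 ≤ rkN M ({c, c'} ∪ Mset)) → s ∉ clF M Mset ∧ ∀ a ∈ P, ∀ b ∈ P, a ≠ b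
      → s ∈ clF M {a, b} → rkN M (insert w₀ (insert x {a, b})) ≤ 3 → 4 ≤ rkN M ({a, b} ∪ Mset) := by
  subst hV hP hW hMset hP₃ hM' hL₀ hP₂ hAset hLset
  set V := (G \ coloops M G) \ {w₀, x} with hV
  set P := (insert z B \ coloops M G).erase w₀ with hP
  set W := (G \ insert z B).erase x with hW
  set Mset := V.filter (fun e => e ∈ clF M (insert c₃ R₁) ∧ e ∉ clF M R₁) with hMset
  set P₃ := P.filter (fun e => e ∈ Mset) with hP₃
  set M' := W.filter (fun e => e ∈ Mset) with hM'
  set L₀ := P.filter (fun e => e ∈ clF M R₁) with hL₀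
  set P₂ := P.filter (fun e => e ∈ clF M (insert c₂ R₁) ∧ e ∉ clF M R₁) with hP₂
  set Aset := V.filter (fun e => e ∈ clF M (insert c₂ R₁) ∧ e ∉ clF M R₁) with hAset
  set Lset := V.filter (fun e => e ∈ clF M R₁) with hLset
  have _u := hd
  have _u := hk
  have _u := hfat
  have _u := hR₁2
  have _u := hR₁3
  have _u := hcop
  have _u := hnd₂
  have _u := hdeg₃
  have _u := hP4
  have _u := hM3
  have _u := hM2
  have _u := hP₃2
  have _u := hMsplit
  have _u := hM'1
  have _u := hL₀2
  have _u := hπ₂3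
  have _u := hL₀P₂
  have _u := hsplit
  have _u := hL3
  intro hL1 s hsW hsL hsM hcc
  refine ⟨hsM, ?_⟩
  apply free_of_spine_point hs hVg hR₁V hR₁2 hc₂V hc₃V hc₂ hc₃ hcover hPV hWV hPW
    (w₀ := w₀) (x := x) ?_ hsW hsL hsM
  · intro c hc c' hc' hcc' hc2 hcL hc'2 hc'L
    exact hcc c (Finset.mem_filter.2 ⟨hc, hc2, hcL⟩) c' (Finset.mem_filter.2 ⟨hc', hc'2, hc'L⟩) hcc'
  · intro a ha b hb hab haL hbL
    have : ({a, b} : Finset α) ⊆ L₀ := by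
      intro e he
      rw [Finset.mem_insert, Finset.mem_singleton] at he
      rcases he with rfl | rfl
      · exact Finset.mem_filter.2 ⟨ha, haL⟩
      · exact Finset.mem_filter.2 ⟨hb, hbL⟩
    have := Finset.card_le_card this
    rw [Finset.card_pair hab] at this
    omega

end PercRepro.Shadow
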